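import Summits.AnomalousDissipation.AnomalousDissipation.Theorems.ImpulseGridGridSignsLawOfAcdc
import Summits.AnomalousDissipation.AnomalousDissipation.Theorems.ImpulseGridGridThesisStubLaplacianPairingBound
import Summits.AnomalousDissipation.AnomalousDissipation.Theorems.ImpulseGridGridSignsLawStubAcdcGridAdmissible
import Summits.AnomalousDissipation.AnomalousDissipation.Theorems.ImpulseGridGridSignsLawStubProfileFluxLaw
import Summits.AnomalousDissipation.AnomalousDissipation.Theorems.ImpulseGridGridSignsLawStubWakeEnergyFloor
import Summits.AnomalousDissipation.AnomalousDissipation.Theorems.ImpulseGridGridSignsLawStubLoudWakes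
import Summits.AnomalousDissipation.AnomalousDissipation.Theorems.ImpulseGridGridThesisStubAcdcStrainBound
import Summits.AnomalousDissipation.AnomalousDissipation.Theorems.ImpulseGridGridSignsLawStubAcdcQuadratureDictionary
import Summits.AnomalousDissipation.AnomalousDissipation.Theorems.ImpulseGridGridSignsLawStubAcdcPatternNormSq
import Summits.AnomalousDissipation.AnomalousDissipation.Theorems.ImpulseGridGridSignsLawStubAcdcWakeEnergyFloorExplicit

/-!
# Line `Sketch` (card `mean-wake-quadrant`) for crux `GridSignsLaw`
(item stmt-AnomalousDissipation-14349, route ImpulseGrid) — lead skeleton, reshape 4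
(lead continuation c2, 2026-08-17; reshape 3 by lead c1, 2026-08-16)

The crux `GridSignsLaw` asks for ONE grid design `(Φ, Ψ, G, c)` such that EVERY bounded-energy
vanishing-viscosity drift family of global Leray–Hopf solutions forced by `Φ • G` eventually
satisfies, in one generalized long-time limit `Λ`, the two grid sign conditions
(a) `0 ≤ Λ⟨(G, u_j)⟩` and (b) `Λ⟨∫⟪w_j, (w_j·∇)(Ψ G)⟫⟩ ≤ -η`, `w_j = u_j - c e₀`.

## The line (first-moment reduction) and what is landed

Reshapes 1–2 (previous lead): the crux is EQUIVALENT to its first-moment form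
(`gridSignsLaw_iff_firstMomentLaw`, tree file `ImpulseGridGridSignsLawFirstMomentForm`, p105372):
same design, same families, eventually non-negative DC work `0 ≤ Λ⟨(G,u_j)⟩` and an AC-work floor
`κ ≤ Λ⟨((Φ−1)•G,u_j)⟩`. Also landed: the free half `0 ≤ DC + AC` (`firstMoment_dc_add_ac_nonneg`,
p106461) and the steady-branch necessary condition (`gridSignsLaw_steady_necessary`, p107104).

Reshape 3 (this lead): the abstract `∃ design` is DISCHARGED by the explicit AC/DC grid of the
sibling `GridThesis` line (`stub_acdcDesignCalculus`, `stub_acdcDesignIntegrals`):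
`Φ = 1 + 2θ cos 2πx₀`, `Ψ = (θ/π) sin 2πx₀`,
`G = A [sin 2πm(x₁+x₂) (e₁−e₂) + sin 2πm(x₁−x₂) (e₁+e₂)]`, drift `c`; the physics is isolated as a
statement about ONE explicit force with four real parameters; the transfer (b) runs through the
card's second stub, the profile flux law (`x₀`-moment hierarchy) at the weight `ρ = Ψ`.

Reshape 4 (lead c2, 2026-08-17): the COMPOSITION itself is now a tree theorem,
`gridSignsLaw_of_acdcFirstMomentLaw : AcdcFirstMomentLaw → GridSignsLaw` (file
`ImpulseGridGridSignsLawOfAcdc`, p140472), where the route crux `AcdcFirstMomentLaw`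
(stmt-AnomalousDissipation-18236, filed by the crux strategist of stmt-1770 on 2026-08-17) is
VERBATIM the open physics stub below. `GridSignsLaw_of` is therefore the one-liner
`gridSignsLaw_of_acdcFirstMomentLaw stub_firstMomentLawACDC`: the crux is closed modulo stmt-18236
inside the tree, and closes by modus ponens the moment that item is settled.

## Stubs (registered 2026-08-16T14:5xZ; reshape 3; unchanged in reshape 4)

LANDED (tree, all `--supports stmt-AnomalousDissipation-14349`, imported below):
* `stub_acdcGridAdmissible` (file `ImpulseGridGridSignsLawStubAcdcGridAdmissible`, p112659) — the
  explicit AC/DC grid satisfies the fifteen design clauses of `GridSignsLaw` (`m ≥ 1`, `A, θ, c > 0`).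
* `stub_profileFluxLaw` (file `ImpulseGridGridSignsLawStubProfileFluxLaw`, p113427; card stub
  `ProfileFluxLaw`) — for every smooth `x₀`-weight `ρ`:
  `c·Λ⟨(∂₀ρ•G,u)⟩ + Λ⟨∫⟪w,(w·∇)(ρG)⟫⟩ + νΛ⟨(u,Δ(ρG))⟩ + ∫Φρ‖G‖² = 0`.
* `stub_wakeEnergyFloor` (file `ImpulseGridGridSignsLawStubWakeEnergyFloor`, p113928; free law) — a
  grid wake is never quiet: `∫Φ‖G‖² + νΛ⟨(u,ΔG)⟩ ≤ σ·Λ⟨‖u − c e₀‖²⟩` for EVERY global Leray–Hopf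
  solution with a sup-energy bound (`σ` = strain bound of `G`; for the AC/DC pattern `σ = 4πmA` by the
  tree's `stub_acdcStrainBound`, so `Λ⟨‖w‖²⟩ ≥ ‖G‖₂²/(4πmA) − O(ν)`).
* `stub_loudWakes_of_gridSignsLaw` (file `ImpulseGridGridSignsLawStubLoudWakes`, p113568; necessary
  condition) — the crux implies a ν-uniform injection floor `ι ≤ Λ⟨(Φ•G,u_j)⟩ ≤ limsup`-mean for
  every bounded-energy wake of its design (a zeroth-law-type statement).

WAVE 2 companion stubs (LANDED, imported below): `stub_acdcQuadratureDictionary` (file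
`ImpulseGridGridSignsLawStubAcdcQuadratureDictionary`, p115077), `stub_acdcPatternNormSq`
(`…StubAcdcPatternNormSq`, p115047), `stub_acdcWakeEnergyFloorExplicit`
(`…StubAcdcWakeEnergyFloorExplicit`, p114927):
* `stub_acdcQuadratureDictionary` — `2πc·Λ⟨(C,u)⟩ = −Λ⟨∫⟪w,(w·∇)S⟫⟩ − νΛ⟨(u,ΔS)⟩` and
  `2πc·Λ⟨(S,u)⟩ = Λ⟨∫⟪w,(w·∇)C⟫⟩ + νΛ⟨(u,ΔC)⟩ + θ‖G‖₂²` (profile flux law at `ρ = ±(2π)⁻¹ sin/cos`):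
  conjunct (b) for this design ⟺ the wake stress destroys the quadrature imprint `S`.
* `stub_acdcPatternNormSq` — `∫‖G‖² = 2A²`.
* `stub_acdcWakeEnergyFloorExplicit` — `∫‖G‖² − 8π²m²ν·Λ⟨(u,G)⟩ ≤ 4πmA·Λ⟨‖u − c e₀‖²⟩`.

OPEN PHYSICS (the only non-companion `sorry` of this file):
* `stub_firstMomentLawACDC` — THE PHYSICS (held by the lead; conjecture-grade): for some parameters
  `(m, A, θ, c)` every bounded-energy drift family of the AC/DC grid has eventually `0 ≤ DC` and
  `κ ≤ AC`.
-/

noncomputable section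

open MeasureTheory Set Filter Topology
open scoped InnerProductSpace RealInnerProductSpace

-- `Summit.<Summit>.<Problem>` is the tree's mandated summit-side namespace (CONVENTIONS §2).
set_option linter.dupNamespace false

namespace Summit.AnomalousDissipation.AnomalousDissipation.Theorems

open Literature.Analysis.FunctionSpaces Literature.Analysis.FunctionSpaces.Torus
open Literature.Analysis.FluidPDE Literature.Analysis.FluidPDE.Torus
open Summit.AnomalousDissipation.AnomalousDissipation.Theses.ImpulseGrid

local notation "𝕋³" => UnitAddTorus (Fin 3)
local notation "E³" => EuclideanSpace ℝ (Fin 3)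

/-! ### The open stub (physics) -/

/-- **STUB (physics; conjecture-grade): the first-moment law of the explicit AC/DC grid.** There are
parameters `m ≥ 1`, `A, θ, c > 0` such that for the force `Φ•G`, `Φ = 1 + 2θ cos 2πx₀`,
`G = A[sin 2πm(x₁+x₂)(e₁−e₂) + sin 2πm(x₁−x₂)(e₁+e₂)]`, EVERY vanishing-viscosity global
Leray–Hopf family with drift data `∫u₀ⱼ = c e₀`, per-`j` sup-energy bounds and `meanEnergy ≤ E`
admits `κ > 0`, one generalized limit `Λ` and a threshold `J` with, for `j ≥ J`, non-negative DC
work `0 ≤ Λ⟨(G, u_j)⟩` (the circuit-mean imprint is not reversed) and an AC-work floor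
`κ ≤ Λ⟨((Φ−1)•G, u_j)⟩ = 2θ Λ⟨(cos(2πx₀) G, u_j)⟩` (the imprint is larger at the slab than on
circuit average). With `stub_acdcGridAdmissible` it implies the crux (composition below); it is the
`∀`-family form of the sibling `GridThesis` line's eddy-drag conclusions (`stub_dcWorkOfDrag`,
`stub_acWorkOfQuadratureDrag`) for the same fields, and it implies a ν-uniform injection floor for
this force (`stub_loudWakes_of_gridSignsLaw`) — a zeroth-law-type statement; no technique in the
tree or in print proves it. Intended regime (route thesis): `m ≫ 1`, `c²/m ≲ A ≪ c²`. [folklore] -/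
theorem stub_firstMomentLawACDC :
    ∃ (m : ℕ) (A θ c : ℝ), 1 ≤ m ∧ 0 < A ∧ 0 < θ ∧ 0 < c ∧
      ∀ (Φ : 𝕋³ → ℝ) (G : 𝕋³ → E³),
        Φ = (fun x => 1 + 2 * θ * (UnitAddTorus.mFourier (Pi.single (0 : Fin 3) (1 : ℤ)) x).re) →
        G = (fun x => A • (stokesMode ![(0 : ℤ), (m : ℤ), (m : ℤ)]
              (EuclideanSpace.single (1 : Fin 3) (1 : ℝ) - EuclideanSpace.single (2 : Fin 3) (1 : ℝ)) false x +
            stokesMode ![(0 : ℤ), (m : ℤ), -(m : ℤ)]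
              (EuclideanSpace.single (1 : Fin 3) (1 : ℝ) + EuclideanSpace.single (2 : Fin 3) (1 : ℝ)) false x)) →
        ∀ (ν : ℕ → ℝ) (u₀ : ℕ → 𝕋³ → E³) (u : ℕ → ℝ → 𝕋³ → E³) (E : ℝ),
          (∀ j, 0 < ν j) → Tendsto ν atTop (𝓝 0) →
          (∀ j, IsGlobalLerayHopf (ν j) (fun _ => fun x => Φ x • G x) (u₀ j) (u j)) →
          (∀ j, ∃ C : ℝ, ∀ t : ℝ, 0 ≤ t → kineticEnergy (u j t) ≤ C) →
          (∀ j, ∫ x, u₀ j x = c • EuclideanSpace.single 0 1) →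
          (∀ j, meanEnergy (u j) ≤ E) →
          ∃ κ : ℝ, 0 < κ ∧ ∃ (Λ : GeneralizedLimit) (J : ℕ), ∀ j, J ≤ j →
            0 ≤ Λ.longTimeAvg (fun t => ∫ x, ⟪G x, u j t x⟫) ∧
            κ ≤ Λ.longTimeAvg (fun t => ∫ x, ⟪(Φ x - 1) • G x, u j t x⟫) := by
  sorry

/-! ### The composition -/

/-- **Composition (sorry-free modulo the stub): the explicit first-moment law implies the crux.**
Reshape 4: the stub is verbatim the route crux `AcdcFirstMomentLaw` (stmt-18236), and the landed
bridge `gridSignsLaw_of_acdcFirstMomentLaw` (p140472; parameters from the law, the fifteen design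
clauses by `stub_acdcGridAdmissible`, then `gridSignsLaw_of_firstMomentLaw` with `η := cκ/2` via the
profile flux law at `ρ = Ψ` and the ν-uniform Laplacian pairing bound) concludes. [folklore] -/
theorem GridSignsLaw_of : GridSignsLaw :=
  gridSignsLaw_of_acdcFirstMomentLaw stub_firstMomentLawACDC

end Summit.AnomalousDissipation.AnomalousDissipation.Theorems

end
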